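import Mathlib.LinearAlgebra.Matrix.PosDef
import Mathlib.Analysis.SpecialFunctions.Trigonometric.Basic
import HarnessLib

/-!
# Venture YMGap — Theorem C (sharp Hessian constant `4d` of the Wilson action), kernel part T0.1:
# the DIAGONAL SECTOR of the single-plaquette lemma is positive semidefinite

HONEST FRAMING: venture file (cell `pub-ymgap`, track (a), item A2 = "Theorem C" of
`p2/HESSIAN-SHARP.md`, referee-checked inside the cell, NOT yet kernel-checked as a whole). This file
kernel-checks ONE algebraic brick of that proof — target T0.1 of `p2/LEAN-TARGETS-A2.md` — and nothing
else: no statement about the Wilson action, Bakry–Émery constants or thresholds is made here.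

The brick (HESSIAN-SHARP §2, proof of Lemma 2 (SPL), diagonal sector (i)): after diagonalising the
plaquette holonomy `W = diag(e^{iθ_a})`, the diagonal entries `(Y_i)_{aa} = i u_i` (`u ∈ ℝ⁴`, one real
number per link of the plaquette) contribute to the slack `2Σ|Y_i|² − (h_p + γ_p)` the quadratic form
`q_c(u) = 2|u|² + c (Σ_i u_i)² + 2(u₁u₂ + u₂u₃ + u₃u₄ + u₄u₁) = uᵀ(2I + cJ + A_{C₄})u`, `c = cos θ_a`,
`J` the all-ones matrix, `A_{C₄}` the adjacency matrix of the 4-cycle (links in cyclic order around the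
plaquette). CLAIM T0.1: `q_c(u) ≥ 0` for every `c ≥ -1` (so for every `c = cos θ`). PROOF (the one-line
SOS of HESSIAN-SHARP §7(e)): `q_c(u) = (1 + c)(u₁+u₂+u₃+u₄)² + (u₁ − u₃)² + (u₂ − u₄)²`.
(Eigen-structure, not needed: `4 + 4c` on `(1,1,1,1)`, `2` on `(1,0,-1,0)`, `(0,1,0,-1)`, `0` on
`(1,-1,1,-1)` — so the form is tight for every `W`, HESSIAN-SHARP Remark (a).)

Contents: `diagSectorForm` (the form), `diagSectorForm_eq_sos` (the identity, `ring`),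
`diagSectorForm_nonneg` (`c ≥ -1`), `diagSectorForm_cos_nonneg` (`c = cos θ`), `diagSectorMatrix c`
(`2I + cJ + A_{C₄}` as a `Matrix (Fin 4) (Fin 4) ℝ`), `diagSectorMatrix_quadForm` (its quadratic form is
`diagSectorForm`), `diagSectorMatrix_posSemidef` (`Matrix.PosSemidef` for `c ≥ -1`), and the kernel
vector `diagSectorForm_alt_eq_zero` (tightness).

Reference: cell file `run/shared/lean/pub/pub-ymgap/p2/HESSIAN-SHARP.md` §2 (i), §7 (e); targets list
`p2/LEAN-TARGETS-A2.md` T0.1. Background: H. Shen, R. Zhu, X. Zhu, CMP 400 (2023) 805, Lemma 4.1 (the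
`8(d-1)` Hessian count this theorem sharpens to `4d`).
-/

namespace Summit.Ventures.YMGap.HessianSharp

open Matrix Finset

/-- The diagonal-sector quadratic form of the single-plaquette lemma:
`q_c(u) = 2|u|² + c(Σu)² + 2(u₀u₁ + u₁u₂ + u₂u₃ + u₃u₀)` (links `0,1,2,3` in cyclic order). -/
def diagSectorForm (c : ℝ) (u : Fin 4 → ℝ) : ℝ :=
  2 * (u 0 ^ 2 + u 1 ^ 2 + u 2 ^ 2 + u 3 ^ 2) + c * (u 0 + u 1 + u 2 + u 3) ^ 2 +
    2 * (u 0 * u 1 + u 1 * u 2 + u 2 * u 3 + u 3 * u 0)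

/-- **The SOS identity** `q_c(u) = (1+c)(u₀+u₁+u₂+u₃)² + (u₀−u₂)² + (u₁−u₃)²`
(HESSIAN-SHARP §7(e)). -/
theorem diagSectorForm_eq_sos (c : ℝ) (u : Fin 4 → ℝ) :
    diagSectorForm c u =
      (1 + c) * (u 0 + u 1 + u 2 + u 3) ^ 2 + (u 0 - u 2) ^ 2 + (u 1 - u 3) ^ 2 := by
  unfold diagSectorForm
  ring

/-- **T0.1**: the diagonal sector is non-negative for every `c ≥ -1`. -/
theorem diagSectorForm_nonneg {c : ℝ} (hc : -1 ≤ c) (u : Fin 4 → ℝ) : 0 ≤ diagSectorForm c u := by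
  rw [diagSectorForm_eq_sos]
  have h1 : 0 ≤ 1 + c := by linarith
  positivity

/-- In particular for `c = cos θ` (the case of the proof: `θ = θ_a`, an eigen-angle of the plaquette
holonomy). -/
theorem diagSectorForm_cos_nonneg (θ : ℝ) (u : Fin 4 → ℝ) : 0 ≤ diagSectorForm (Real.cos θ) u :=
  diagSectorForm_nonneg (Real.neg_one_le_cos θ) u

/-- Tightness: the alternating vector `(1,-1,1,-1)` is in the kernel for every `c`
(HESSIAN-SHARP Remark (a): SPL is tight for every `W`). -/
theorem diagSectorForm_alt_eq_zero (c : ℝ) : diagSectorForm c ![1, -1, 1, -1] = 0 := by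
  simp [diagSectorForm]
  norm_num

/-- The matrix `D(c) = 2I + cJ + A_{C₄}` of the diagonal sector: `D_ii = 2 + c`, `D_ij = c + 1` if
`|i - j| ∈ {1, 3}` (cyclic neighbours), `D_ij = c` if `|i - j| = 2`. -/
def diagSectorMatrix (c : ℝ) : Matrix (Fin 4) (Fin 4) ℝ :=
  Matrix.of fun i j =>
    if i = j then 2 + c
    else if (i.val + 1) % 4 = j.val ∨ (j.val + 1) % 4 = i.val then c + 1
    else c

/-- `D(c)` is symmetric. -/
theorem diagSectorMatrix_isHermitian (c : ℝ) : (diagSectorMatrix c).IsHermitian := by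
  rw [Matrix.IsHermitian]
  ext i j
  simp only [diagSectorMatrix, conjTranspose_apply, of_apply, star_trivial]
  fin_cases i <;> fin_cases j <;> simp

/-- The quadratic form of `D(c)` is `diagSectorForm c`. -/
theorem diagSectorMatrix_quadForm (c : ℝ) (u : Fin 4 → ℝ) :
    u ⬝ᵥ (diagSectorMatrix c).mulVec u = diagSectorForm c u := by
  simp only [diagSectorMatrix, diagSectorForm, mulVec, dotProduct, Fin.sum_univ_four, of_apply]
  simp (config := { decide := true }) only [Fin.isValue]
  norm_num
  ring

/-- **T0.1, matrix form**: `D(c) = 2I + cJ + A_{C₄}` is positive semidefinite for every `c ≥ -1`. -/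
theorem diagSectorMatrix_posSemidef {c : ℝ} (hc : -1 ≤ c) : (diagSectorMatrix c).PosSemidef := by
  refine Matrix.PosSemidef.of_dotProduct_mulVec_nonneg (diagSectorMatrix_isHermitian c) fun u => ?_
  rw [star_trivial, diagSectorMatrix_quadForm]
  exact diagSectorForm_nonneg hc u

end Summit.Ventures.YMGap.HessianSharp
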